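import Summits.Ventures.LatticeQCDFlow.Scaling.ParallelTemperingPairCycleMoves
import Summits.Ventures.LatticeQCDFlow.Scaling.ParallelTemperingExactLevelLaw

/-!
HONEST FRAMING: exact (Metropolis-corrected) sampling algorithms for lattice gauge theory; figures
of merit are autocorrelation/cost numbers at stated couplings and volumes; no continuum-physics
claim.

# ParallelTemperingHalfSweep — PTBC AS RUN: THE EVEN AND ODD HALF-SWEEPS OF SWAP ATTEMPTS AS MARKOV KERNELS IN
# DETAILED BALANCE, AND THE EXACT TAG LAW OF THE RANDOM-PARITY HALF-SWEEP `ρ_τ(1) = 1 − 3ā_K/(K(K+2))` —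
# LITERALLY THE SIMULATED-TEMPERING LEVEL LAW (lean-2 GEN-15, ours)

Venture-side (OURS).  Cell `lqcd-flow` (pub-lqcd), unit `pub-lqcd-lean-2-g15`, 2026-08-24.  GEN-14's exact tag law
(`Scaling/ParallelTemperingExactLevelLaw`) is per swap ATTEMPT at one uniformly chosen pair:
`ρ_τ(1) = 1 − 6ā_K/(K²(K+2))`.  PTBC as run (Hasenbusch 2017; Bonanno–Bonati–D'Elia 2021) attempts ALL `K` adjacent
swaps once per cycle, as the half-sweep over the even pairs `(0,1), (2,3), …` and the half-sweep over the odd pairs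
`(1,2), (3,4), …` — each a composition of COMMUTING pair kernels (GEN-15 `Scaling/ParallelTemperingPairCycle`).  This
file types the two half-sweeps and the random-parity half-sweep `H = ½E + ½O` and proves: `E`, `O`, `H` are Markov,
in detailed balance with the tagged target, move the tag by at most one level, and move it with probability EXACTLY
`Σ_{j even} ptTagCoef_j·r_j`, `Σ_{j odd} ptTagCoef_j·r_j`, `½·ptSwapRatio` respectively; hence by GEN-14's identity
`ρ(1) = 1 − 6r̄/(K(K+2))` (`Scaling/SimulatedTemperingExactLevelLaw.level_lagOneAutocorr_eq`) the tag of the sampler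
`M ∘ₖ H` (`M` ANY tag-preserving exact replica update) has `ρ_τ(1) = 1 − 3ā_K/(K(K+2))` per half-sweep,
`ā_K = (2/(K+1))·Σ_j swapAcc(β_j, β_{j+1})` — the SAME formula as the simulated-tempering level law of
`Scaling/SimulatedTemperingExactLevelLaw` (`K/2` attempts in one step decorrelate exactly `K/2` times as much as one).

## What is defined / proved (`X` bounded measurable, `μ` a probability measure)

* §1 `ptParityPairs K p` (the pairs `j < K` with `j % 2 = p`; pairwise disjoint: `pairwise_apart_ptParityPairs`);
  **`ptParitySweep hXm β K p`** `= ptPairCycle (ptParityPairs K p)`: Markov, `invariant_ptParitySweep`,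
  **`isReversible_ptParitySweep`**, `ptParitySweep_nearestNeighbour`, **`ptParitySweep_real_moves_eq`**
  (`= Σ_{j % 2 = p} ptTagCoef_j·r_j`), `ptParitySweep_moveRate_eq` (`= (2/(K+1))·Σ_{j % 2 = p} swapAcc_j`);
  `sum_even_add_sum_odd` (the two halves add up to `ptSwapRatio` / to `ā_K`).
* §2 **`ptHalfSweep hXm β K = mixtureKernel ½ E O`**: Markov, invariant, **reversible**, nearest-neighbour,
  **`ptHalfSweep_real_moves_eq`** (`= ½·ptSwapRatio`), **`ptHalfSweep_moveRate_eq`** (`= ½ā_K`).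
* §3 EXACT LAWS (`K ≥ 1`): **`ptHalfSweep_level_lagOneAutocorr_eq`** (`H` alone),
  **`ptHalfScan_level_lagOneAutocorr_eq`** (`M ∘ₖ H`, `M` tag-preserving Markov), `…_before` (`H ∘ₖ M`, `M` also
  target-invariant): `ρ_τ(1) = 1 − 3ā_K/(K(K+2))`.
* the two-sided ladder law per half-sweep and its attainment with `K* = ⌈(b−a)√(2M)⌉` gaps are the companion
  `Scaling/ParallelTemperingHalfSweepLadder`.

NOT CLAIMED: the deterministic alternation `O ∘ₖ E` as one step (moves the tag by up to two levels; only GEN-13's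
movement BOUND applies, not the identity); `τ_int` identities; irreducibility; anything measured.  Literature grade
(cell rule): TEXTBOOK ALGORITHM (PTBC: Hasenbusch, PRD 96 (2017) 054504; Bonanno–Bonati–D'Elia, JHEP 03 (2021) 111;
even/odd replica-exchange schedules: Hukushima–Nemoto 1996), KNOWN MECHANISM (random-walk ladder motion,
Katzgraber–Trebst–Huse–Troyer 2006), NEW TYPING (kernel-exact identity); nothing cited as a fact; no new bib keys.
-/

noncomputable section

open MeasureTheory ProbabilityTheory Set Filter Finset
open Summit.Ventures.LatticeQCDFlow.Exactness Summit.Ventures.LatticeQCDFlow.Scoring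
open scoped ENNReal

namespace Summit.Ventures.LatticeQCDFlow.Scaling

/-! ## §1 The even and the odd half-sweep -/

section Parity

variable {Ω : Type*} [MeasurableSpace Ω] {X : Ω → ℝ} {μ : Measure Ω} {β : ℕ → ℝ} {K : ℕ}

/-- The adjacent pairs `(j, j+1)`, `j < K`, of parity `p` (`j % 2 = p`), in increasing order. [ours] -/
def ptParityPairs (K p : ℕ) : List (Fin K) := (List.finRange K).filter fun j => (j : ℕ) % 2 = p

omit [MeasurableSpace Ω] in
/-- Pairs of equal parity are pairwise DISJOINT. [folklore] -/
theorem pairwise_apart_ptParityPairs (K p : ℕ) :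
    (ptParityPairs K p).Pairwise fun j j' : Fin K => (j : ℕ) + 2 ≤ j' ∨ (j' : ℕ) + 2 ≤ j := by
  unfold ptParityPairs
  rw [List.pairwise_filter]
  refine (List.pairwise_lt_finRange K).imp fun {j j'} hlt hj hj' => ?_
  simp only [decide_eq_true_eq] at hj hj'
  have hlt' : (j : ℕ) < j' := hlt
  left
  omega

omit [MeasurableSpace Ω] in
/-- As a finset, the parity class is `univ.filter (· % 2 = p)`. [folklore] -/
theorem toFinset_ptParityPairs (K p : ℕ) :
    (ptParityPairs K p).toFinset = Finset.univ.filter fun j : Fin K => (j : ℕ) % 2 = p := by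
  classical
  unfold ptParityPairs
  rw [List.toFinset_filter, List.toFinset_finRange]
  ext j
  simp

/-- **THE HALF-SWEEP OF PARITY `p`**: the swap attempts at all pairs `(j, j+1)` with `j % 2 = p`, composed (they
commute, so the order is immaterial). [ours] -/
def ptParitySweep {X : Ω → ℝ} (hXm : Measurable X) (β : ℕ → ℝ) (K p : ℕ) :
    Kernel (Fin (K + 1) × (Fin (K + 1) → Ω)) (Fin (K + 1) × (Fin (K + 1) → Ω)) :=
  ptPairCycle hXm β K (ptParityPairs K p)

/-- The half-sweep is Markov. [ours] -/
instance isMarkovKernel_ptParitySweep (hXm : Measurable X) (p : ℕ) : IsMarkovKernel (ptParitySweep hXm β K p) := by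
  unfold ptParitySweep; infer_instance

/-- **(i) the half-sweep leaves the tagged target invariant.** [ours] -/
theorem invariant_ptParitySweep [IsProbabilityMeasure μ] (hXm : Measurable X) (hXb : ∃ C, ∀ x, |X x| ≤ C) (p : ℕ) :
    Kernel.Invariant (ptParitySweep hXm β K p) (ptTaggedTarget X μ β K) :=
  invariant_ptPairCycle hXm hXb _

/-- **DETAILED BALANCE OF THE HALF-SWEEP.** [ours] -/
theorem isReversible_ptParitySweep [IsProbabilityMeasure μ] (hXm : Measurable X) (hXb : ∃ C, ∀ x, |X x| ≤ C)
    (p : ℕ) : Kernel.IsReversible (ptParitySweep hXm β K p) (ptTaggedTarget X μ β K) :=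
  isReversible_ptPairCycle hXm hXb (pairwise_apart_ptParityPairs K p)

/-- **(ii) the half-sweep moves the tag by at most one level.** [ours] -/
theorem ptParitySweep_nearestNeighbour (hXm : Measurable X) (p : ℕ) (z : Fin (K + 1) × (Fin (K + 1) → Ω)) :
    ∀ᵐ y ∂(ptParitySweep hXm β K p z), |(((y.1 : Fin (K + 1)) : ℕ) : ℝ) - ((z.1 : Fin (K + 1)) : ℕ)| ≤ 1 :=
  ptPairCycle_nearestNeighbour hXm (pairwise_apart_ptParityPairs K p) z

/-- **(iii) THE EXACT TAG-MOVE PROBABILITY OF THE HALF-SWEEP**: `Σ_{j % 2 = p} ptTagCoef K j (tag z)·r_j(z)`. [ours] -/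
theorem ptParitySweep_real_moves_eq (hXm : Measurable X) (p : ℕ) (z : Fin (K + 1) × (Fin (K + 1) → Ω)) :
    (ptParitySweep hXm β K p z).real {y | ((y.1 : Fin (K + 1)) : ℕ) ≠ ((z.1 : Fin (K + 1)) : ℕ)} =
      ∑ j ∈ Finset.univ.filter (fun j : Fin K => (j : ℕ) % 2 = p), ptTagCoef K j z.1 * ptPairRatio X β K j z.2 := by
  unfold ptParitySweep
  rw [ptPairCycle_real_moves_eq hXm (pairwise_apart_ptParityPairs K p) z, toFinset_ptParityPairs]

/-- The half-sweep moves the tag with probability at most `ptSwapRatio`. [ours] -/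
theorem ptParitySweep_real_moves_le (hXm : Measurable X) (p : ℕ) (z : Fin (K + 1) × (Fin (K + 1) → Ω)) :
    (ptParitySweep hXm β K p z).real {y | ((y.1 : Fin (K + 1)) : ℕ) ≠ ((z.1 : Fin (K + 1)) : ℕ)} ≤
      ptSwapRatio X β K z :=
  ptPairCycle_real_moves_le_ptSwapRatio hXm (pairwise_apart_ptParityPairs K p) z

/-- **The stationary tag-move rate of the half-sweep**: `(2/(K+1))·Σ_{j % 2 = p} swapAcc X μ β_j β_{j+1}`. [ours] -/
theorem ptParitySweep_moveRate_eq [IsProbabilityMeasure μ] (hXm : Measurable X) (hXb : ∃ C, ∀ x, |X x| ≤ C) (p : ℕ) :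
    ∫ z, (ptParitySweep hXm β K p z).real {y | ((y.1 : Fin (K + 1)) : ℕ) ≠ ((z.1 : Fin (K + 1)) : ℕ)}
        ∂(ptTaggedTarget X μ β K) =
      2 / (K + 1) * ∑ j ∈ Finset.univ.filter (fun j : Fin K => (j : ℕ) % 2 = p),
        swapAcc X μ (β (j : ℕ)) (β ((j : ℕ) + 1)) := by
  unfold ptParitySweep
  rw [ptPairCycle_moveRate_eq hXm hXb (pairwise_apart_ptParityPairs K p), toFinset_ptParityPairs]

omit [MeasurableSpace Ω] in
/-- Even plus odd is everything: `Σ_{j even} f + Σ_{j odd} f = Σ_j f`. [folklore] -/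
theorem sum_even_add_sum_odd (f : Fin K → ℝ) :
    ∑ j ∈ Finset.univ.filter (fun j : Fin K => (j : ℕ) % 2 = 0), f j +
      ∑ j ∈ Finset.univ.filter (fun j : Fin K => (j : ℕ) % 2 = 1), f j = ∑ j, f j := by
  have e : Finset.univ.filter (fun j : Fin K => (j : ℕ) % 2 = 1) =
      Finset.univ.filter (fun j : Fin K => ¬ ((j : ℕ) % 2 = 0)) := by
    ext j
    simp only [Finset.mem_filter, Finset.mem_univ, true_and]
    omega
  rw [e, Finset.sum_filter_add_sum_filter_not]

end Parity

/-! ## §2 The random-parity half-sweep `H = ½E + ½O` -/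

section Half

variable {Ω : Type*} [MeasurableSpace Ω] {X : Ω → ℝ} {μ : Measure Ω} {β : ℕ → ℝ} {K : ℕ}

/-- One half, as a point of the unit interval. [folklore] -/
def oneHalf : unitInterval := ⟨1 / 2, by norm_num, by norm_num⟩

/-- `oneHalf` is `1/2`. [folklore] -/
@[simp] theorem coe_oneHalf : ((oneHalf : unitInterval) : ℝ) = 1 / 2 := rfl

/-- **THE RANDOM-PARITY HALF-SWEEP**: with probability `½` the even half-sweep, else the odd one. [ours] -/
def ptHalfSweep {X : Ω → ℝ} (hXm : Measurable X) (β : ℕ → ℝ) (K : ℕ) :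
    Kernel (Fin (K + 1) × (Fin (K + 1) → Ω)) (Fin (K + 1) × (Fin (K + 1) → Ω)) :=
  mixtureKernel oneHalf (ptParitySweep hXm β K 0) (ptParitySweep hXm β K 1)

/-- The random-parity half-sweep is Markov. [ours] -/
instance isMarkovKernel_ptHalfSweep (hXm : Measurable X) : IsMarkovKernel (ptHalfSweep hXm β K) := by
  unfold ptHalfSweep; infer_instance

/-- **(i) it leaves the tagged target invariant.** [ours] -/
theorem invariant_ptHalfSweep [IsProbabilityMeasure μ] (hXm : Measurable X) (hXb : ∃ C, ∀ x, |X x| ≤ C) :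
    Kernel.Invariant (ptHalfSweep hXm β K) (ptTaggedTarget X μ β K) :=
  invariant_mixtureKernel _ (invariant_ptParitySweep hXm hXb 0) (invariant_ptParitySweep hXm hXb 1)

/-- **DETAILED BALANCE of the random-parity half-sweep.** [ours] -/
theorem isReversible_ptHalfSweep [IsProbabilityMeasure μ] (hXm : Measurable X) (hXb : ∃ C, ∀ x, |X x| ≤ C) :
    Kernel.IsReversible (ptHalfSweep hXm β K) (ptTaggedTarget X μ β K) :=
  isReversible_mixtureKernel _ (isReversible_ptParitySweep hXm hXb 0) (isReversible_ptParitySweep hXm hXb 1)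

/-- **(ii) it moves the tag by at most one level.** [ours] -/
theorem ptHalfSweep_nearestNeighbour (hXm : Measurable X) (z : Fin (K + 1) × (Fin (K + 1) → Ω)) :
    ∀ᵐ y ∂(ptHalfSweep hXm β K z), |(((y.1 : Fin (K + 1)) : ℕ) : ℝ) - ((z.1 : Fin (K + 1)) : ℕ)| ≤ 1 := by
  rw [ae_iff]
  unfold ptHalfSweep
  exact mixtureKernel_null _ _ _ z (ae_iff.1 (ptParitySweep_nearestNeighbour hXm 0 z))
    (ae_iff.1 (ptParitySweep_nearestNeighbour hXm 1 z))

/-- **(iii) THE EXACT TAG-MOVE PROBABILITY OF THE RANDOM-PARITY HALF-SWEEP IS `½·ptSwapRatio`.** [ours] -/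
theorem ptHalfSweep_real_moves_eq (hXm : Measurable X) (z : Fin (K + 1) × (Fin (K + 1) → Ω)) :
    (ptHalfSweep hXm β K z).real {y | ((y.1 : Fin (K + 1)) : ℕ) ≠ ((z.1 : Fin (K + 1)) : ℕ)} =
      1 / 2 * ptSwapRatio X β K z := by
  unfold ptHalfSweep
  rw [mixtureKernel_real, ptParitySweep_real_moves_eq hXm 0 z, ptParitySweep_real_moves_eq hXm 1 z, coe_oneHalf,
    ptSwapRatio, ← sum_even_add_sum_odd (fun j => ptTagCoef K j z.1 * ptPairRatio X β K j z.2)]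
  ring

/-- It moves the tag with probability at most `ptSwapRatio` (GEN-13's hypothesis (iii)). [ours] -/
theorem ptHalfSweep_real_moves_le (hXm : Measurable X) (z : Fin (K + 1) × (Fin (K + 1) → Ω)) :
    (ptHalfSweep hXm β K z).real {y | ((y.1 : Fin (K + 1)) : ℕ) ≠ ((z.1 : Fin (K + 1)) : ℕ)} ≤
      ptSwapRatio X β K z := by
  rw [ptHalfSweep_real_moves_eq hXm z]
  have h := ptSwapRatio_nonneg (X := X) (β := β) z
  linarith

/-- **THE STATIONARY TAG-MOVE RATE OF THE RANDOM-PARITY HALF-SWEEP IS `½ā_K`**: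
`∫ H(z){tag moves} dπ = ½·(2/(K+1))·Σ_j swapAcc X μ β_j β_{j+1}`. [ours] -/
theorem ptHalfSweep_moveRate_eq [IsProbabilityMeasure μ] (hXm : Measurable X) (hXb : ∃ C, ∀ x, |X x| ≤ C) :
    ∫ z, (ptHalfSweep hXm β K z).real {y | ((y.1 : Fin (K + 1)) : ℕ) ≠ ((z.1 : Fin (K + 1)) : ℕ)}
        ∂(ptTaggedTarget X μ β K) =
      1 / 2 * (2 / (K + 1) * ∑ j : Fin K, swapAcc X μ (β (j : ℕ)) (β ((j : ℕ) + 1))) := by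
  simp only [ptHalfSweep_real_moves_eq hXm]
  rw [integral_const_mul, pt_moveRate_eq hXm hXb]

end Half

/-! ## §3 The exact tag law per half-sweep: `ρ_τ(1) = 1 − 3ā_K/(K(K+2))` -/

section Law

variable {Ω : Type*} [MeasurableSpace Ω] {X : Ω → ℝ} {μ : Measure Ω} [IsProbabilityMeasure μ] {β : ℕ → ℝ} {K : ℕ}

/-- **EXACT TAG LAW OF THE RANDOM-PARITY HALF-SWEEP ALONE** (`K ≥ 1`):
`ρ_τ(1) = 1 − 3ā_K/(K(K+2))`, `ā_K = (2/(K+1))·Σ_j swapAcc X μ β_j β_{j+1}`. [ours] -/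
theorem ptHalfSweep_level_lagOneAutocorr_eq (hXm : Measurable X) (hXb : ∃ C, ∀ x, |X x| ≤ C) (hK : 1 ≤ K) :
    (autocov (ptHalfSweep hXm β K) (ptTaggedTarget X μ β K) (fun z => (((z.1 : Fin (K + 1)) : ℕ) : ℝ)) 1 -
        ((K : ℝ) / 2) ^ 2) / (K * (K + 2) / 12) =
      1 - 3 * (2 / (K + 1) * ∑ j : Fin K, swapAcc X μ (β (j : ℕ)) (β ((j : ℕ) + 1))) / (K * (K + 2)) := by
  haveI := isProbabilityMeasure_ptTaggedTarget (μ := μ) (β := β) (K := K) hXm hXb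
  rw [level_lagOneAutocorr_eq (lev := fun z : Fin (K + 1) × (Fin (K + 1) → Ω) => ((z.1 : Fin (K + 1)) : ℕ))
    (invariant_ptHalfSweep hXm hXb) measurable_ptLevel (fun z => Nat.le_of_lt_succ z.1.isLt) hK
    (fun k hk => ptTaggedTarget_real_level hXm hXb k hk) (ptHalfSweep_nearestNeighbour hXm),
    ptHalfSweep_moveRate_eq hXm hXb]
  ring

/-- **EXACT TAG LAW OF THE PTBC SAMPLER `M ∘ₖ H`** — any tag-preserving Markov replica update `M` followed by the
random-parity half-sweep of swap attempts (`K ≥ 1`): `ρ_τ(1) = 1 − 3ā_K/(K(K+2))` per half-sweep — the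
simulated-tempering level law, exactly. [ours] -/
theorem ptHalfScan_level_lagOneAutocorr_eq (hXm : Measurable X) (hXb : ∃ C, ∀ x, |X x| ≤ C) (hK : 1 ≤ K)
    (M : Kernel (Fin (K + 1) × (Fin (K + 1) → Ω)) (Fin (K + 1) × (Fin (K + 1) → Ω))) [IsMarkovKernel M]
    (hM : ∀ y, M y {y' | ((y'.1 : Fin (K + 1)) : ℕ) ≠ ((y.1 : Fin (K + 1)) : ℕ)} = 0) :
    (autocov (M ∘ₖ ptHalfSweep hXm β K) (ptTaggedTarget X μ β K) (fun z => (((z.1 : Fin (K + 1)) : ℕ) : ℝ)) 1 -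
        ((K : ℝ) / 2) ^ 2) / (K * (K + 2) / 12) =
      1 - 3 * (2 / (K + 1) * ∑ j : Fin K, swapAcc X μ (β (j : ℕ)) (β ((j : ℕ) + 1))) / (K * (K + 2)) := by
  rw [autocov_comp_levelPreserving_after (lev := fun z : Fin (K + 1) × (Fin (K + 1) → Ω) => ((z.1 : Fin (K + 1)) : ℕ))
    (f := fun z : Fin (K + 1) × (Fin (K + 1) → Ω) => (((z.1 : Fin (K + 1)) : ℕ) : ℝ))
    (L := ptHalfSweep hXm β K) hM (measurable_from_nat.comp measurable_ptLevel)
    (abs_level_le fun z : Fin (K + 1) × (Fin (K + 1) → Ω) => Nat.le_of_lt_succ z.1.isLt) (fun y y' h => by simp only [h])]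
  exact ptHalfSweep_level_lagOneAutocorr_eq hXm hXb hK

/-- **EXACT TAG LAW OF `H ∘ₖ M`** ("update the replicas, then a half-sweep of swaps"; `M` tag-preserving and
target-invariant, `K ≥ 1`): `ρ_τ(1) = 1 − 3ā_K/(K(K+2))`. [ours] -/
theorem ptHalfScan_level_lagOneAutocorr_eq_before (hXm : Measurable X) (hXb : ∃ C, ∀ x, |X x| ≤ C) (hK : 1 ≤ K)
    (M : Kernel (Fin (K + 1) × (Fin (K + 1) → Ω)) (Fin (K + 1) × (Fin (K + 1) → Ω))) [IsMarkovKernel M]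
    (hM : ∀ y, M y {y' | ((y'.1 : Fin (K + 1)) : ℕ) ≠ ((y.1 : Fin (K + 1)) : ℕ)} = 0)
    (hπM : Kernel.Invariant M (ptTaggedTarget X μ β K)) :
    (autocov (ptHalfSweep hXm β K ∘ₖ M) (ptTaggedTarget X μ β K) (fun z => (((z.1 : Fin (K + 1)) : ℕ) : ℝ)) 1 -
        ((K : ℝ) / 2) ^ 2) / (K * (K + 2) / 12) =
      1 - 3 * (2 / (K + 1) * ∑ j : Fin K, swapAcc X μ (β (j : ℕ)) (β ((j : ℕ) + 1))) / (K * (K + 2)) := by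
  haveI := isProbabilityMeasure_ptTaggedTarget (μ := μ) (β := β) (K := K) hXm hXb
  rw [autocov_comp_levelPreserving_before (lev := fun z : Fin (K + 1) × (Fin (K + 1) → Ω) => ((z.1 : Fin (K + 1)) : ℕ))
    (f := fun z : Fin (K + 1) × (Fin (K + 1) → Ω) => (((z.1 : Fin (K + 1)) : ℕ) : ℝ))
    (L := ptHalfSweep hXm β K) hπM hM (measurable_from_nat.comp measurable_ptLevel)
    (abs_level_le fun z : Fin (K + 1) × (Fin (K + 1) → Ω) => Nat.le_of_lt_succ z.1.isLt) (fun y y' h => by simp only [h])]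
  exact ptHalfSweep_level_lagOneAutocorr_eq hXm hXb hK

end Law

end Summit.Ventures.LatticeQCDFlow.Scaling

end
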